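import Summits.QuantumFields.BalabanUV.Beta.FP.KktUnitConjugation
import Summits.QuantumFields.BalabanUV.Beta.FP.RelInvPeriodised

/-!
# `BalabanUV.Beta.FP.OneShotSocketUnit` — road «FP» for binder row D1, ROUTE T: **THE UNIT BRIDGE AT THE (S3-1) ONE-SHOT SOCKETS** — from leaf-05's four sockets
# instantiated at a BARE chart (whose periodised border is `c • 𝔔`, `c = S⁻¹`, the HONEST `hQ` of `FP/TorusCompositeRowsChart`) to #41d's four sockets at the door's
# pinned `𝔔` with the UNIT-CONJUGATED chart kernel `unitK 1 c A` (route (b) of leaf-02 g27 W-2; pure matrix algebra, no chart letter touched)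

WHY.  At an2's chart of record `𝕄 := bhKcomp r Lc ·` the block identification that HOLDS is `S • (perF T 𝕄).submatrix f (ff) = 𝔔` (R-3), so leaf-05's
`PackedLegOneShotSockets.towerN_* ∕ towerF_*` produce a right inverse `X` and a presented leg for the system `kkt H₀ [S⁻¹ • 𝔔; P]`, while #41d's `hXN hLN ∕ hXF hLF`
are stated for `kkt H₀ [𝔔; P]`.  THIS FILE is the transfer: the unit on the `𝔔`-rows ONLY (the comb rows `P` untouched) is a two-sided DIAGONAL conjugation of the
`kkt` system; conjugating `X` back gives a right inverse of #41d's system whose packed leg is the SAME four block formulas over the unit-conjugated kernel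
`unitK 1 c A` (`HessKerDressedUnits.unitK`, `KernelPeriodisationFib.perF_unitK`), and the torus rules transfer because `Ê = perF T (axEc ρ N)` is diagonal
(`RelInvPeriodised.perF_axEc`).  So #41d″ may take `AN := unitK 1 S_N⁻¹ A_{K-U3d}`, `AF := unitK 1 S_F⁻¹ A_{K-U3d}` with an2's seven letters UNCHANGED (the
alternative (a) — conjugating the chart PAIR and transferring the seven letters — is the row's; either way the (S3-2) TABLES inherit the unit).

WHAT (generic index types; `c : ℝ`, `c ≠ 0` where inverted):
* §1 (U6) `kkt_fromRows_smul`: `kkt H [c • Q; P] = diagonal w · kkt H [Q; P] · diagonal w`, `w = Sum.elim 1 (Sum.elim c 1)`; `diagonal_rowUnit_mul_inv`;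
  (U7) `kkt_fromRows_mul_rightInverse_of_smul`: `kkt H [c • Q; P] · X = 1 ⟹ kkt H [Q; P] · (diagonal w · X · diagonal w) = 1`;
  (U8) `submatrix_leg_rowUnit`: the `(field ⊕ 𝔔)`-leg of the conjugate is `diag(1, c) · X_leg · diag(1, c)` (#40a (U3) `submatrix_diagonal_mul_mul_diagonal`).
* §2 (U9) `leg_rowUnit_eq`: `diag(1, c) · fromBlocks Γ I (−L) (−S) · diag(1, c)` over `perF T A` = the same four blocks over `perF T (unitK 1 c A)` (slots `fN`
  `inr`-valued); (U10) `perF_rules_unitK`: `Ê·Â = Â ∧ Â·Ê = Â ⟹` the same for `perF T (unitK sf sm A)`; (U11) `leg_rowUnit_of_leg`: #41d's `hLN ∕ hLF` literal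
  for the conjugate from leaf-05's leg literal for `X`.
* §3 AT THE RECORD's LITERAL (inputs = leaf-05's conclusions at `𝔔♭` VERBATIM + the honest unit identity `hunit : S • 𝔔♭ = 𝔔` = R-3's shape, `S ≠ 0`):
  (U12) `rightInverse_of_unit` (#41d's `hXN ∕ hXF` with `X′ := diagonal w · X · diagonal w`, `w = Sum.elim 1 (Sum.elim S⁻¹ 1)`), (U13) `leg_of_unit` (#41d's `hLN ∕ hLF` over
  `perF T (unitK 1 S⁻¹ A)`); the rules `hEAN hAEN ∕ hEAF hAEF` = (U10) at `(sf, sm) = (1, S⁻¹)`.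
[folklore] matrix algebra BY NAME over #40a, `perF_unitK ∕ perF_scaleK_apply`, `perF_axEc`; no `def`, no `def … : Prop`, nothing cited, 0 sorry.  Nothing of the
dictionary ∕ Bałaban's asserted; no chart letter, no table, no `hessT` identity here (the END's unit bookkeeping across N ∕ F ∕ G is the OWNER's, #40a (U5) pattern).

HONEST DEPENDENCY (page 1, mandatory): continuum YM on T⁴ ⇐ BetaPertH ∧ nine spine estimates (0/9 proved); BetaPertH ⇐ (D1) ∧ (D4) ∧ CAP+tail;
G-an2-4 gates asym, D1 and NE2/3/4.  HONEST FRAMING (cell contract, verbatim): «discharging `BetaPertH` makes Bałaban's UV stability UNCONDITIONAL —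
a real constructive-QFT result; it is NOT the continuum limit and NOT the Clay problem.»  ABSOLUTE RULE (cell charter, verbatim): «No internally-minted
statement may enter as a cited fact. Every hypothesis is either kernel-proved in this package or a verbatim quotation of a PUBLISHED theorem with page
reference. The manuscript(s) under audit are NOT citable for their own disputed steps — they are the thing under adjudication; programme-internal
(2001/route/tribunal) claims are never citable.»  0 estimates; 0∕4 row-D1 binders (hW, hR, D1Tel, D1Rep); NOT (T-ID), NOT (C1), NOT SDF, NOT D1,
NOT BetaPertH, NOT continuum, NOT Clay.  D1 formalisation swarm LEAF PROVER 02 (b2b-balaban-beta-d1-formalise-leaf-02 gen 27), 2026-08-23.  No existing file touched.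
-/

noncomputable section

open scoped Matrix

namespace Summit.QuantumFields.BalabanUV.Beta.FP.OneShotSocketUnit

open Matrix
open Literature.MathematicalPhysics.QuantumFieldTheory.Balaban1983to89.Beta.Composition (kkt)
open Summit.QuantumFields.BalabanUV.Beta.FP.KktUnitConjugation (submatrix_diagonal_mul_mul_diagonal)
open Literature.MathematicalPhysics.QuantumFieldTheory.Balaban1983to89
open Literature.MathematicalPhysics.QuantumFieldTheory.Balaban1983to89.Beta
open B6Lemma24Torus (pbox)
open ExpKernelCalculus (MKer)
open AffineAveraging (Site)
open OneStepResolventKernel (Fib)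
open Summit.QuantumFields.BalabanUV.Beta.AxialDressingRooted (axEc)
open Summit.QuantumFields.BalabanUV.Beta.HessKerDressedUnits (unitK legScale legScale_inl legScale_inr)
open Summit.QuantumFields.BalabanUV.Beta.FP.KernelPeriodisationFib (Idx perF perF_unitK perF_scaleK_apply)
open Summit.QuantumFields.BalabanUV.Beta.FP.RelInvPeriodised (perF_axEc)

variable {ν κ ρ : Type*} [Fintype ν] [Fintype κ] [Fintype ρ] [DecidableEq ν] [DecidableEq κ] [DecidableEq ρ]

/-- [folklore] (U6) **THE UNIT ON THE `𝔔`-ROWS ONLY IS A TWO-SIDED DIAGONAL CONJUGATION**: `kkt H [c • Q; P] = diagonal w · kkt H [Q; P] · diagonal w`,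
`w = Sum.elim 1 (Sum.elim c 1)` on `ν ⊕ (κ ⊕ ρ)` (the comb rows `P` untouched). -/
theorem kkt_fromRows_smul (c : ℝ) (H : Matrix ν ν ℝ) (Q : Matrix κ ν ℝ) (P : Matrix ρ ν ℝ) :
    kkt H (fromRows (c • Q) P)
      = diagonal (Sum.elim (fun _ : ν => (1 : ℝ)) (Sum.elim (fun _ : κ => c) (fun _ : ρ => (1 : ℝ))))
          * kkt H (fromRows Q P) * diagonal (Sum.elim (fun _ : ν => (1 : ℝ)) (Sum.elim (fun _ : κ => c) (fun _ : ρ => (1 : ℝ)))) := by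
  ext i j
  rw [Matrix.mul_diagonal, Matrix.diagonal_mul]
  unfold kkt
  rcases i with i | (i | i) <;> rcases j with j | (j | j) <;>
    simp [fromBlocks, fromRows, Matrix.transpose_apply, mul_comm]

/-- [folklore] the two unit diagonals are inverse to each other (`c ≠ 0`). -/
theorem diagonal_rowUnit_mul_inv (c : ℝ) (hc : c ≠ 0) :
    diagonal (Sum.elim (fun _ : ν => (1 : ℝ)) (Sum.elim (fun _ : κ => c) (fun _ : ρ => (1 : ℝ))))
        * diagonal (Sum.elim (fun _ : ν => (1 : ℝ)) (Sum.elim (fun _ : κ => c⁻¹) (fun _ : ρ => (1 : ℝ)))) = 1 := by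
  rw [Matrix.diagonal_mul_diagonal, ← Matrix.diagonal_one]
  congr 1
  funext i
  rcases i with i | (i | i) <;> simp [mul_inv_cancel₀ hc]

/-- [folklore] (U7) **RIGHT-INVERSE TRANSFER ACROSS THE ROW UNIT**: if `kkt H [c • Q; P] · X = 1` (`c ≠ 0`) then
`kkt H [Q; P] · (diagonal w · X · diagonal w) = 1`, `w = Sum.elim 1 (Sum.elim c 1)`. -/
theorem kkt_fromRows_mul_rightInverse_of_smul (c : ℝ) (hc : c ≠ 0) (H : Matrix ν ν ℝ) (Q : Matrix κ ν ℝ) (P : Matrix ρ ν ℝ)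
    (X : Matrix (ν ⊕ (κ ⊕ ρ)) (ν ⊕ (κ ⊕ ρ)) ℝ) (hX : kkt H (fromRows (c • Q) P) * X = 1) :
    kkt H (fromRows Q P)
        * (diagonal (Sum.elim (fun _ : ν => (1 : ℝ)) (Sum.elim (fun _ : κ => c) (fun _ : ρ => (1 : ℝ)))) * X
            * diagonal (Sum.elim (fun _ : ν => (1 : ℝ)) (Sum.elim (fun _ : κ => c) (fun _ : ρ => (1 : ℝ))))) = 1 := by
  -- `kkt H [Q; P] = kkt H [c⁻¹ • (c • Q); P] = diag(w⁻¹) · kkt H [c • Q; P] · diag(w⁻¹)`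
  have hQ : Q = c⁻¹ • (c • Q) := by rw [smul_smul, inv_mul_cancel₀ hc, one_smul]
  have h1 := diagonal_rowUnit_mul_inv (ν := ν) (κ := κ) (ρ := ρ) c⁻¹ (inv_ne_zero hc)
  rw [inv_inv] at h1
  have h2 := diagonal_rowUnit_mul_inv (ν := ν) (κ := κ) (ρ := ρ) c hc
  conv_lhs => rw [hQ, kkt_fromRows_smul c⁻¹ H (c • Q) P]
  calc diagonal (Sum.elim (fun _ : ν => (1 : ℝ)) (Sum.elim (fun _ : κ => c⁻¹) (fun _ : ρ => (1 : ℝ)))) * kkt H (fromRows (c • Q) P)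
          * diagonal (Sum.elim (fun _ : ν => (1 : ℝ)) (Sum.elim (fun _ : κ => c⁻¹) (fun _ : ρ => (1 : ℝ))))
          * (diagonal (Sum.elim (fun _ : ν => (1 : ℝ)) (Sum.elim (fun _ : κ => c) (fun _ : ρ => (1 : ℝ)))) * X
            * diagonal (Sum.elim (fun _ : ν => (1 : ℝ)) (Sum.elim (fun _ : κ => c) (fun _ : ρ => (1 : ℝ)))))
      = diagonal (Sum.elim (fun _ : ν => (1 : ℝ)) (Sum.elim (fun _ : κ => c⁻¹) (fun _ : ρ => (1 : ℝ))))
          * (kkt H (fromRows (c • Q) P)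
            * ((diagonal (Sum.elim (fun _ : ν => (1 : ℝ)) (Sum.elim (fun _ : κ => c⁻¹) (fun _ : ρ => (1 : ℝ))))
                * diagonal (Sum.elim (fun _ : ν => (1 : ℝ)) (Sum.elim (fun _ : κ => c) (fun _ : ρ => (1 : ℝ))))) * X))
          * diagonal (Sum.elim (fun _ : ν => (1 : ℝ)) (Sum.elim (fun _ : κ => c) (fun _ : ρ => (1 : ℝ)))) := by
        simp only [Matrix.mul_assoc]
    _ = 1 := by rw [h1, Matrix.one_mul, hX, Matrix.mul_one, h1]

/-- [folklore] (U8) **THE PACKED LEG UNDER THE ROW UNIT**: restricting `diagonal w · X · diagonal w` to the `(field ⊕ 𝔔)`-slots gives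
`diag(1, c) · X_leg · diag(1, c)` (#40a (U3)). -/
theorem submatrix_leg_rowUnit (c : ℝ) (X : Matrix (ν ⊕ (κ ⊕ ρ)) (ν ⊕ (κ ⊕ ρ)) ℝ) :
    (diagonal (Sum.elim (fun _ : ν => (1 : ℝ)) (Sum.elim (fun _ : κ => c) (fun _ : ρ => (1 : ℝ)))) * X
        * diagonal (Sum.elim (fun _ : ν => (1 : ℝ)) (Sum.elim (fun _ : κ => c) (fun _ : ρ => (1 : ℝ))))).submatrix (Sum.map id Sum.inl) (Sum.map id Sum.inl)
      = diagonal (Sum.elim (fun _ : ν => (1 : ℝ)) (fun _ : κ => c)) * X.submatrix (Sum.map id Sum.inl) (Sum.map id Sum.inl)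
          * diagonal (Sum.elim (fun _ : ν => (1 : ℝ)) (fun _ : κ => c)) := by
  rw [submatrix_diagonal_mul_mul_diagonal]
  have hw : (Sum.elim (fun _ : ν => (1 : ℝ)) (Sum.elim (fun _ : κ => c) (fun _ : ρ => (1 : ℝ)))) ∘ Sum.map id Sum.inl
      = Sum.elim (fun _ : ν => (1 : ℝ)) (fun _ : κ => c) := by
    funext i; rcases i with i | i <;> rfl
  rw [hw]


/-! ## §2 The torus side: the four leg blocks and the two rules under the unit `unitK 1 c` of the chart kernel -/

section Torus

variable {d : ℕ} (T : Fin (d + 1) → ℕ) {κ' : Type*} [Fintype κ'] [DecidableEq κ']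

/-- [folklore] entries of `perF T (unitK 1 c A)`: field legs unscaled, multiplier legs scaled by `c` on each side. -/
theorem perF_unitK_one_apply (c : ℝ) (A : MKer (d + 1) (Fib d)) (p q : Idx T (Fib d)) :
    perF T (unitK 1 c A) p q = legScale (d := d) 1 c p.2 * perF T A p q * legScale (d := d) 1 c q.2 := by
  unfold unitK
  exact perF_scaleK_apply T _ _ A p q

/-- [folklore] (U9) **THE FOUR LEG BLOCKS UNDER THE ROW UNIT**: `diag(1, c) · fromBlocks Γ I (−L) (−S) · diag(1, c)` over `perF T A` IS the same four blocks over
`perF T (unitK 1 c A)` (the slot presentation `fN` being `inr`-valued). -/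
theorem leg_rowUnit_eq (c : ℝ) (A : MKer (d + 1) (Fib d)) (ρ : Fin (d + 1) → ℤ) (N : ℕ) (fN : κ' → Idx T (Fib d))
    (hmN : ∀ a : κ', ∃ m : Fin (d + 1), (fN a).2 = Sum.inr m) :
    diagonal (Sum.elim (fun _ : ↥(pbox T) × Fin (d + 1) => (1 : ℝ)) (fun _ : κ' => c))
        * fromBlocks
          (Matrix.of fun (b b' : ↥(pbox T) × Fin (d + 1)) =>
            axEc ρ N (b.1 : Site (d + 1)) (b.1 : Site (d + 1)) (Sum.inl b.2) (Sum.inl b.2)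
              * (axEc ρ N (b'.1 : Site (d + 1)) (b'.1 : Site (d + 1)) (Sum.inl b'.2) (Sum.inl b'.2) * perF T A (b.1, Sum.inl b.2) (b'.1, Sum.inl b'.2)))
          (Matrix.of fun (b : ↥(pbox T) × Fin (d + 1)) (a : κ') =>
            axEc ρ N (b.1 : Site (d + 1)) (b.1 : Site (d + 1)) (Sum.inl b.2) (Sum.inl b.2) * perF T A (b.1, Sum.inl b.2) (fN a))
          (-Matrix.of fun (a : κ') (b : ↥(pbox T) × Fin (d + 1)) =>
            axEc ρ N (b.1 : Site (d + 1)) (b.1 : Site (d + 1)) (Sum.inl b.2) (Sum.inl b.2) * perF T A (fN a) (b.1, Sum.inl b.2))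
          (-((perF T A).submatrix fN fN))
        * diagonal (Sum.elim (fun _ : ↥(pbox T) × Fin (d + 1) => (1 : ℝ)) (fun _ : κ' => c))
      = fromBlocks
          (Matrix.of fun (b b' : ↥(pbox T) × Fin (d + 1)) =>
            axEc ρ N (b.1 : Site (d + 1)) (b.1 : Site (d + 1)) (Sum.inl b.2) (Sum.inl b.2)
              * (axEc ρ N (b'.1 : Site (d + 1)) (b'.1 : Site (d + 1)) (Sum.inl b'.2) (Sum.inl b'.2)
                * perF T (unitK 1 c A) (b.1, Sum.inl b.2) (b'.1, Sum.inl b'.2)))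
          (Matrix.of fun (b : ↥(pbox T) × Fin (d + 1)) (a : κ') =>
            axEc ρ N (b.1 : Site (d + 1)) (b.1 : Site (d + 1)) (Sum.inl b.2) (Sum.inl b.2) * perF T (unitK 1 c A) (b.1, Sum.inl b.2) (fN a))
          (-Matrix.of fun (a : κ') (b : ↥(pbox T) × Fin (d + 1)) =>
            axEc ρ N (b.1 : Site (d + 1)) (b.1 : Site (d + 1)) (Sum.inl b.2) (Sum.inl b.2) * perF T (unitK 1 c A) (fN a) (b.1, Sum.inl b.2))
          (-((perF T (unitK 1 c A)).submatrix fN fN)) := by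
  have hleg : ∀ a : κ', legScale (d := d) 1 c (fN a).2 = c := fun a => by
    obtain ⟨m, hm⟩ := hmN a; rw [hm, legScale_inr]
  ext (i | i) (j | j)
  · simp only [diagonal_mul, mul_diagonal, Sum.elim_inl, fromBlocks_apply₁₁, Matrix.of_apply, perF_unitK_one_apply, legScale_inl, one_mul,
      mul_one]
  · simp only [diagonal_mul, mul_diagonal, Sum.elim_inl, Sum.elim_inr, fromBlocks_apply₁₂, Matrix.of_apply, perF_unitK_one_apply, legScale_inl,
      hleg, one_mul]
    ring
  · simp only [diagonal_mul, mul_diagonal, Sum.elim_inl, Sum.elim_inr, fromBlocks_apply₂₁, Matrix.neg_apply, Matrix.of_apply, perF_unitK_one_apply,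
      legScale_inl, hleg, mul_one]
    ring
  · simp only [diagonal_mul, mul_diagonal, Sum.elim_inr, fromBlocks_apply₂₂, Matrix.neg_apply, Matrix.submatrix_apply, perF_unitK_one_apply, hleg]
    ring

/-- [folklore] (U10) **THE TORUS RULES UNDER THE UNIT**: `Ê` is diagonal (`perF_axEc`), so `Ê·Â = Â` and `Â·Ê = Â` transfer to `Â′ := perF T (unitK sf sm A) =
D·Â·D`. -/
theorem perF_rules_unitK [∀ μ, NeZero (T μ)] (sf sm : ℝ) (A : MKer (d + 1) (Fib d)) (ρ : Fin (d + 1) → ℤ) (N : ℕ)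
    (hEA : perF T (axEc ρ N) * perF T A = perF T A) (hAE : perF T A * perF T (axEc ρ N) = perF T A) :
    perF T (axEc ρ N) * perF T (unitK sf sm A) = perF T (unitK sf sm A)
      ∧ perF T (unitK sf sm A) * perF T (axEc ρ N) = perF T (unitK sf sm A) := by
  rw [perF_unitK]
  set D : Matrix (Idx T (Fib d)) (Idx T (Fib d)) ℝ := diagonal (fun p : Idx T (Fib d) => legScale (d := d) sf sm p.2) with hD
  have hcomm : perF T (axEc ρ N) * D = D * perF T (axEc ρ N) := by
    rw [perF_axEc, hD, Matrix.diagonal_mul_diagonal, Matrix.diagonal_mul_diagonal]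
    congr 1; funext p; ring
  constructor
  · calc perF T (axEc ρ N) * (D * perF T A * D) = (perF T (axEc ρ N) * D) * perF T A * D := by simp only [Matrix.mul_assoc]
      _ = D * (perF T (axEc ρ N) * perF T A) * D := by rw [hcomm]; simp only [Matrix.mul_assoc]
      _ = D * perF T A * D := by rw [hEA]
  · calc D * perF T A * D * perF T (axEc ρ N) = D * perF T A * (D * perF T (axEc ρ N)) := by simp only [Matrix.mul_assoc]
      _ = D * (perF T A * perF T (axEc ρ N)) * D := by rw [← hcomm]; simp only [Matrix.mul_assoc]
      _ = D * perF T A * D := by rw [hAE]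

/-- [folklore] (U11) **THE PACKED LEG ACROSS THE ROW UNIT, IN THE SOCKET's WORDS**: if the leg of `X` (a right inverse of `kkt H [c • 𝔔; P]`) is the four blocks
over `perF T A`, then the leg of `diagonal w · X · diagonal w` (a right inverse of `kkt H [𝔔; P]`, (U7)) is the same four blocks over `perF T (unitK 1 c A)` —
#41d's `hLN ∕ hLF` literal at the unit-conjugated chart kernel. -/
theorem leg_rowUnit_of_leg (c : ℝ) (A : MKer (d + 1) (Fib d)) (ρ : Fin (d + 1) → ℤ) (N : ℕ) (fN : κ' → Idx T (Fib d))
    (hmN : ∀ a : κ', ∃ m : Fin (d + 1), (fN a).2 = Sum.inr m) {ρ' : Type*} [Fintype ρ'] [DecidableEq ρ']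
    (X : Matrix ((↥(pbox T) × Fin (d + 1)) ⊕ (κ' ⊕ ρ')) ((↥(pbox T) × Fin (d + 1)) ⊕ (κ' ⊕ ρ')) ℝ)
    (hL : X.submatrix (Sum.map id Sum.inl) (Sum.map id Sum.inl) = fromBlocks
          (Matrix.of fun (b b' : ↥(pbox T) × Fin (d + 1)) =>
            axEc ρ N (b.1 : Site (d + 1)) (b.1 : Site (d + 1)) (Sum.inl b.2) (Sum.inl b.2)
              * (axEc ρ N (b'.1 : Site (d + 1)) (b'.1 : Site (d + 1)) (Sum.inl b'.2) (Sum.inl b'.2) * perF T A (b.1, Sum.inl b.2) (b'.1, Sum.inl b'.2)))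
          (Matrix.of fun (b : ↥(pbox T) × Fin (d + 1)) (a : κ') =>
            axEc ρ N (b.1 : Site (d + 1)) (b.1 : Site (d + 1)) (Sum.inl b.2) (Sum.inl b.2) * perF T A (b.1, Sum.inl b.2) (fN a))
          (-Matrix.of fun (a : κ') (b : ↥(pbox T) × Fin (d + 1)) =>
            axEc ρ N (b.1 : Site (d + 1)) (b.1 : Site (d + 1)) (Sum.inl b.2) (Sum.inl b.2) * perF T A (fN a) (b.1, Sum.inl b.2))
          (-((perF T A).submatrix fN fN))) :
    (diagonal (Sum.elim (fun _ : ↥(pbox T) × Fin (d + 1) => (1 : ℝ)) (Sum.elim (fun _ : κ' => c) (fun _ : ρ' => (1 : ℝ)))) * X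
        * diagonal (Sum.elim (fun _ : ↥(pbox T) × Fin (d + 1) => (1 : ℝ)) (Sum.elim (fun _ : κ' => c) (fun _ : ρ' => (1 : ℝ))))).submatrix
          (Sum.map id Sum.inl) (Sum.map id Sum.inl)
      = fromBlocks
          (Matrix.of fun (b b' : ↥(pbox T) × Fin (d + 1)) =>
            axEc ρ N (b.1 : Site (d + 1)) (b.1 : Site (d + 1)) (Sum.inl b.2) (Sum.inl b.2)
              * (axEc ρ N (b'.1 : Site (d + 1)) (b'.1 : Site (d + 1)) (Sum.inl b'.2) (Sum.inl b'.2)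
                * perF T (unitK 1 c A) (b.1, Sum.inl b.2) (b'.1, Sum.inl b'.2)))
          (Matrix.of fun (b : ↥(pbox T) × Fin (d + 1)) (a : κ') =>
            axEc ρ N (b.1 : Site (d + 1)) (b.1 : Site (d + 1)) (Sum.inl b.2) (Sum.inl b.2) * perF T (unitK 1 c A) (b.1, Sum.inl b.2) (fN a))
          (-Matrix.of fun (a : κ') (b : ↥(pbox T) × Fin (d + 1)) =>
            axEc ρ N (b.1 : Site (d + 1)) (b.1 : Site (d + 1)) (Sum.inl b.2) (Sum.inl b.2) * perF T (unitK 1 c A) (fN a) (b.1, Sum.inl b.2))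
          (-((perF T (unitK 1 c A)).submatrix fN fN)) := by
  rw [submatrix_leg_rowUnit, hL]
  exact leg_rowUnit_eq T c A ρ N fN hmN

/-! ## §3 Packaged at the record's literal: inputs = leaf-05's conclusions at `𝔔♭` + the HONEST unit identity `S • 𝔔♭ = 𝔔` (R-3's shape) -/

/-- [folklore] (U12) **#41d's RIGHT-INVERSE SOCKET FROM leaf-05's AT THE BARE CHART**: if `kkt H [𝔔♭; P] · X = 1` and `S • 𝔔♭ = 𝔔` (`S ≠ 0`), then
`kkt H [𝔔; P] · (diagonal w · X · diagonal w) = 1`, `w = Sum.elim 1 (Sum.elim S⁻¹ 1)`. -/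
theorem rightInverse_of_unit {ν' ρ' : Type*} [Fintype ν'] [DecidableEq ν'] [Fintype ρ'] [DecidableEq ρ'] (S : ℝ) (hS : S ≠ 0)
    (H : Matrix ν' ν' ℝ) {𝔔 𝔔b : Matrix κ' ν' ℝ} (hunit : S • 𝔔b = 𝔔) (P : Matrix ρ' ν' ℝ)
    (X : Matrix (ν' ⊕ (κ' ⊕ ρ')) (ν' ⊕ (κ' ⊕ ρ')) ℝ) (hX : kkt H (fromRows 𝔔b P) * X = 1) :
    kkt H (fromRows 𝔔 P)
        * (diagonal (Sum.elim (fun _ : ν' => (1 : ℝ)) (Sum.elim (fun _ : κ' => S⁻¹) (fun _ : ρ' => (1 : ℝ)))) * X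
            * diagonal (Sum.elim (fun _ : ν' => (1 : ℝ)) (Sum.elim (fun _ : κ' => S⁻¹) (fun _ : ρ' => (1 : ℝ))))) = 1 := by
  have hb : 𝔔b = S⁻¹ • 𝔔 := by rw [← hunit, smul_smul, inv_mul_cancel₀ hS, one_smul]
  subst hb
  exact kkt_fromRows_mul_rightInverse_of_smul S⁻¹ (inv_ne_zero hS) H 𝔔 P X hX

/-- [folklore] (U13) **#41d's LEG SOCKET FROM leaf-05's AT THE BARE CHART**: the leg of `diagonal w · X · diagonal w` (`w` as in (U12)) is #41d's four blocks over
`perF T (unitK 1 S⁻¹ A)`, given leaf-05's four blocks over `perF T A` for `X`. -/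
theorem leg_of_unit (S : ℝ) (A : MKer (d + 1) (Fib d)) (ρ : Fin (d + 1) → ℤ) (N : ℕ) (fN : κ' → Idx T (Fib d))
    (hmN : ∀ a : κ', ∃ m : Fin (d + 1), (fN a).2 = Sum.inr m) {ρ' : Type*} [Fintype ρ'] [DecidableEq ρ']
    (X : Matrix ((↥(pbox T) × Fin (d + 1)) ⊕ (κ' ⊕ ρ')) ((↥(pbox T) × Fin (d + 1)) ⊕ (κ' ⊕ ρ')) ℝ)
    (hL : X.submatrix (Sum.map id Sum.inl) (Sum.map id Sum.inl) = fromBlocks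
          (Matrix.of fun (b b' : ↥(pbox T) × Fin (d + 1)) =>
            axEc ρ N (b.1 : Site (d + 1)) (b.1 : Site (d + 1)) (Sum.inl b.2) (Sum.inl b.2)
              * (axEc ρ N (b'.1 : Site (d + 1)) (b'.1 : Site (d + 1)) (Sum.inl b'.2) (Sum.inl b'.2) * perF T A (b.1, Sum.inl b.2) (b'.1, Sum.inl b'.2)))
          (Matrix.of fun (b : ↥(pbox T) × Fin (d + 1)) (a : κ') =>
            axEc ρ N (b.1 : Site (d + 1)) (b.1 : Site (d + 1)) (Sum.inl b.2) (Sum.inl b.2) * perF T A (b.1, Sum.inl b.2) (fN a))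
          (-Matrix.of fun (a : κ') (b : ↥(pbox T) × Fin (d + 1)) =>
            axEc ρ N (b.1 : Site (d + 1)) (b.1 : Site (d + 1)) (Sum.inl b.2) (Sum.inl b.2) * perF T A (fN a) (b.1, Sum.inl b.2))
          (-((perF T A).submatrix fN fN))) :
    (diagonal (Sum.elim (fun _ : ↥(pbox T) × Fin (d + 1) => (1 : ℝ)) (Sum.elim (fun _ : κ' => S⁻¹) (fun _ : ρ' => (1 : ℝ)))) * X
        * diagonal (Sum.elim (fun _ : ↥(pbox T) × Fin (d + 1) => (1 : ℝ)) (Sum.elim (fun _ : κ' => S⁻¹) (fun _ : ρ' => (1 : ℝ))))).submatrix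
          (Sum.map id Sum.inl) (Sum.map id Sum.inl)
      = fromBlocks
          (Matrix.of fun (b b' : ↥(pbox T) × Fin (d + 1)) =>
            axEc ρ N (b.1 : Site (d + 1)) (b.1 : Site (d + 1)) (Sum.inl b.2) (Sum.inl b.2)
              * (axEc ρ N (b'.1 : Site (d + 1)) (b'.1 : Site (d + 1)) (Sum.inl b'.2) (Sum.inl b'.2)
                * perF T (unitK 1 S⁻¹ A) (b.1, Sum.inl b.2) (b'.1, Sum.inl b'.2)))
          (Matrix.of fun (b : ↥(pbox T) × Fin (d + 1)) (a : κ') =>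
            axEc ρ N (b.1 : Site (d + 1)) (b.1 : Site (d + 1)) (Sum.inl b.2) (Sum.inl b.2) * perF T (unitK 1 S⁻¹ A) (b.1, Sum.inl b.2) (fN a))
          (-Matrix.of fun (a : κ') (b : ↥(pbox T) × Fin (d + 1)) =>
            axEc ρ N (b.1 : Site (d + 1)) (b.1 : Site (d + 1)) (Sum.inl b.2) (Sum.inl b.2) * perF T (unitK 1 S⁻¹ A) (fN a) (b.1, Sum.inl b.2))
          (-((perF T (unitK 1 S⁻¹ A)).submatrix fN fN)) :=
  leg_rowUnit_of_leg T S⁻¹ A ρ N fN hmN X hL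

end Torus

end Summit.QuantumFields.BalabanUV.Beta.FP.OneShotSocketUnit

end
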